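import Summits.ValiantsHypothesis.ValiantsHypothesis.Theorems.PolyaContinuedSignedCoverLittleBijection
import Mathlib.GroupTheory.Perm.Cycle.Basic
import Mathlib.GroupTheory.Perm.Cycle.Factors
import HarnessLib

/-!
# Route PolyaContinued — support item `SignedCoverLittle` (stmt-ValiantsHypothesis-7426):
# adjacency pull-back and the parity endgame

Sequel to `…SignedCoverLittleBijection.lean` (label identity ⇒ label-bijection `PM(H) → PM(E)`).
Two perfect matchings `σ ≠ σ'` of `H ⊆ Fin n × Fin n` are called *adjacent* when the only perfect
matchings of `H` all of whose cells are cells of `σ` or of `σ'` are `σ` and `σ'` themselves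
(equivalently: `σ Δ σ'` is a single alternating cycle). This file proves three generic facts used by
the parity endgame of the label-transfer principle:

* `isCycle_of_adjacent` — if `σ ≠ σ'` are adjacent then `σ⁻¹ * σ'` is a cyclic permutation (its
  support is the set of rows where `σ` and `σ'` differ, `support_inv_mul_eq_filter`); hence
  `sign σ * sign σ' = -(-1) ^ #{i | σ i ≠ σ' i}` (`coe_sign_mul_coe_sign_of_adjacent`, in `ℤ`);
* `adjacent_of_labelIdentity` — **adjacency pulls back along a label bijection**: under the label
  identity `Σ_{σ ⊆ H} Π X (φ (i, σ i)) = PM_E`, if the images `π, π'` of `σ, σ'` are adjacent in `E`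
  then `σ, σ'` are adjacent in `H`;
* `not_isPfaffianBipartite_of_even_multiplicity` — **parity endgame**: if `H` has an EVEN number of
  perfect matchings, one of which is adjacent to all the others, and every cell of `H` lies in an
  even number of perfect matchings, then `H` is not Pfaffian (the product of the Pólya equations
  gives `Π sign σ = 1`, while the cycle structure gives `Π sign σ = -1`).

For the Little obstruction `E = S ⊔ μ` (six pairwise adjacent perfect matchings) this reduces the
item to the combinatorial statement "every cell of `H` lies in an even number of the six perfect
matchings" (NOTES of seat val-width-7426-p1, §M4).
-/

namespace Summit.ValiantsHypothesis.PolyaContinued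

open MvPolynomial Finset Literature.Combinatorics.SimpleGraph Equiv Equiv.Perm

variable {n : ℕ}

/-! ### Adjacent perfect matchings differ by a single cycle -/

/-- The support of `σ⁻¹ * σ'` is the set of rows on which `σ` and `σ'` differ. [folklore] -/
theorem support_inv_mul_eq_filter (σ σ' : Perm (Fin n)) :
    (σ⁻¹ * σ').support = Finset.univ.filter fun i => σ i ≠ σ' i := by
  ext i
  rw [Perm.mem_support, Finset.mem_filter, Perm.mul_apply, Ne, Perm.inv_eq_iff_eq]
  exact ⟨fun h => ⟨Finset.mem_univ _, fun h' => h h'.symm⟩, fun h h' => h.2 h'.symm⟩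

/-- **Adjacent perfect matchings differ by ONE cycle.** If `σ ≠ σ'` and every permutation all of
whose values agree with `σ` or with `σ'` is `σ` or `σ'`, then `σ⁻¹ * σ'` is a cyclic permutation.
(Otherwise switching a single cycle of `σ⁻¹ * σ'` gives a third such permutation.) [folklore] -/
theorem isCycle_of_adjacent {σ σ' : Perm (Fin n)} (hne : σ ≠ σ')
    (hadj : ∀ ρ : Perm (Fin n), (∀ i, ρ i = σ i ∨ ρ i = σ' i) → ρ = σ ∨ ρ = σ') :
    (σ⁻¹ * σ').IsCycle := by
  classical
  set τ := σ⁻¹ * σ' with hτ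
  have hτ1 : τ ≠ 1 := by
    intro h
    apply hne
    have : σ' = σ * τ := by rw [hτ, mul_inv_cancel_left]
    rw [this, h, mul_one]
  obtain ⟨x, hx⟩ : ∃ x, τ x ≠ x := by
    by_contra h
    push Not at h
    exact hτ1 (Equiv.ext h)
  -- the cycle of `τ` through `x`, switched alone
  have hρ := hadj (σ * τ.cycleOf x) fun i => by
    rw [Perm.mul_apply, cycleOf_apply]
    split_ifs
    · right
      simp [hτ, Perm.mul_apply]
    · left; rfl
  rcases hρ with h | h
  · exfalso
    have h1 : τ.cycleOf x = 1 := by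
      have := congrArg (fun ρ => σ⁻¹ * ρ) h
      simpa using this
    rw [cycleOf_eq_one_iff] at h1
    exact hx h1
  · have h1 : τ.cycleOf x = τ := by
      have := congrArg (fun ρ => σ⁻¹ * ρ) h
      simpa [hτ] using this
    rw [← h1]
    exact isCycle_cycleOf τ hx

/-- For adjacent perfect matchings, `sign σ * sign σ' = -(-1) ^ #{i | σ i ≠ σ' i}` (stated in
`ℤ`): an alternating cycle through `k` rows is a `k`-cycle, of sign `(-1)^(k-1)`. [folklore] -/
theorem coe_sign_mul_coe_sign_of_adjacent {σ σ' : Perm (Fin n)} (hne : σ ≠ σ')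
    (hadj : ∀ ρ : Perm (Fin n), (∀ i, ρ i = σ i ∨ ρ i = σ' i) → ρ = σ ∨ ρ = σ') :
    ((Perm.sign σ : ℤˣ) : ℤ) * ((Perm.sign σ' : ℤˣ) : ℤ) =
      -(-1 : ℤ) ^ (Finset.univ.filter fun i => σ i ≠ σ' i).card := by
  have h := (isCycle_of_adjacent hne hadj).sign
  rw [Perm.sign_mul, Perm.sign_inv, support_inv_mul_eq_filter] at h
  have h' := congrArg (Units.val : ℤˣ → ℤ) h
  push_cast at h'
  exact h'

/-- Powers of `z` with `z * z = 1` in `ℤ`: odd powers are `z`. [folklore] -/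
theorem pow_eq_self_of_mul_self_eq_one {z : ℤ} (hz : z * z = 1) {N : ℕ} (hN : N % 2 = 1) :
    z ^ N = z := by
  have hN' : N = 2 * (N / 2) + 1 := by omega
  rw [hN', _root_.pow_succ, _root_.pow_mul, sq, hz, _root_.one_pow, _root_.one_mul]

/-! ### Adjacency pulls back along a label bijection -/

/-- Under `e_φ(σ) = m_π` (the cells of `σ`, read through `φ`, are the cells of `π`), the label of
every cell of `σ` is a cell of `π`: `φ (i, σ i) = (a, π a)` with `a = (φ (i, σ i)).1`. [folklore] -/
theorem label_eq_of_eq {φ : Fin n × Fin n → Fin n × Fin n} {σ π : Perm (Fin n)}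
    (h : (∑ i, Finsupp.single (φ (i, σ i)) 1 : (Fin n × Fin n) →₀ ℕ) = matchingExponent π)
    (i : Fin n) : φ (i, σ i) = ((φ (i, σ i)).1, π (φ (i, σ i)).1) := by
  have := label_mem_of_eq h i
  exact Prod.ext rfl this.symm

/-- **Adjacency pulls back.** Under the label identity, let `σ, σ'` be perfect matchings of `H`
with image matchings `π, π'` of `E` (`e_φ(σ) = m_π`, `e_φ(σ') = m_{π'}`). If `π, π'` are adjacent in
`E` (every perfect matching of `E` inside `π ∪ π'` is `π` or `π'`), then `σ, σ'` are adjacent in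
`H`: every perfect matching of `H` inside `σ ∪ σ'` is `σ` or `σ'`. Indeed such a matching `ρ` is
labelled by a perfect matching of `E` inside `π ∪ π'`, and the label-bijection is injective.
[folklore] -/
theorem adjacent_of_labelIdentity {H E : Finset (Fin n × Fin n)}
    {φ : Fin n × Fin n → Fin n × Fin n}
    (hid : (∑ σ : Equiv.Perm (Fin n), if (∀ i, (i, σ i) ∈ H) then
        ∏ i, (X (φ (i, σ i)) : MvPolynomial (Fin n × Fin n) ℂ) else 0) =
      perfectMatchingPoly E ℂ)
    {σ σ' π π' : Perm (Fin n)} (hσ : ∀ i, (i, σ i) ∈ H) (hσ' : ∀ i, (i, σ' i) ∈ H)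
    (hπ : (∑ i, Finsupp.single (φ (i, σ i)) 1 : (Fin n × Fin n) →₀ ℕ) = matchingExponent π)
    (hπ' : (∑ i, Finsupp.single (φ (i, σ' i)) 1 : (Fin n × Fin n) →₀ ℕ) = matchingExponent π')
    (hadjE : ∀ ρ : Perm (Fin n), (∀ a, (a, ρ a) ∈ E) → (∀ a, ρ a = π a ∨ ρ a = π' a) →
      ρ = π ∨ ρ = π')
    {ρ : Perm (Fin n)} (hρσ : ∀ i, ρ i = σ i ∨ ρ i = σ' i) :
    ρ = σ ∨ ρ = σ' := by
  classical
  have hρ : ∀ i, (i, ρ i) ∈ H := fun i => by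
    rcases hρσ i with h | h
    · rw [h]; exact hσ i
    · rw [h]; exact hσ' i
  -- the image of `ρ`
  obtain ⟨πρ, hπρE, hπρ⟩ := exists_perm_of_labelIdentity hid hρ
  -- every cell of `πρ` is a cell of `π` or of `π'`
  have hcells : ∀ a, πρ a = π a ∨ πρ a = π' a := by
    intro a
    obtain ⟨i, hi⟩ := exists_label_eq_of_eq hπρ a
    rcases hρσ i with h | h
    · left
      have h1 := label_eq_of_eq hπ i
      rw [← h, hi] at h1
      simpa using (Prod.ext_iff.1 h1).2
    · right
      have h1 := label_eq_of_eq hπ' i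
      rw [← h, hi] at h1
      simpa using (Prod.ext_iff.1 h1).2
  rcases hadjE πρ hπρE hcells with h | h
  · left
    exact labelExponent_injective_of_labelIdentity hid hρ hσ (by rw [hπρ, hπ, h])
  · right
    exact labelExponent_injective_of_labelIdentity hid hρ hσ' (by rw [hπρ, hπ', h])

/-! ### The parity endgame -/

/-- Product of the Pólya equations: if every cell lies in an even number of the perfect matchings
of `H`, then for every `±1`-signing `s`, `Π_{σ ∈ PM(H)} Π_i s (i, σ i) = 1`. [folklore] -/
theorem prod_prod_signing_eq_one {H : Finset (Fin n × Fin n)} (s : Fin n × Fin n → ℤˣ)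
    (heven : ∀ c : Fin n × Fin n, Even ((Finset.univ.filter fun σ : Perm (Fin n) =>
      (∀ i, (i, σ i) ∈ H) ∧ σ c.1 = c.2).card)) :
    ∏ σ ∈ (Finset.univ.filter fun σ : Perm (Fin n) => ∀ i, (i, σ i) ∈ H), ∏ i, s (i, σ i) = 1 := by
  classical
  rw [Finset.prod_comm]
  refine Finset.prod_eq_one fun i _ => ?_
  -- group the matchings by the column `σ i`
  rw [Finset.prod_comp (fun j => s (i, j)) (fun σ : Perm (Fin n) => σ i)]
  refine Finset.prod_eq_one fun j _ => ?_
  have hcard : ((Finset.univ.filter fun σ : Perm (Fin n) => ∀ i, (i, σ i) ∈ H).filter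
      fun σ => σ i = j).card =
      (Finset.univ.filter fun σ : Perm (Fin n) => (∀ i, (i, σ i) ∈ H) ∧ σ (i, j).1 = (i, j).2).card := by
    rw [Finset.filter_filter]
  rw [hcard]
  obtain ⟨k, hk⟩ := heven (i, j)
  rw [hk, ← two_mul, _root_.pow_mul, Int.units_sq, _root_.one_pow]

/-- The number of pairs `(σ, i)` with `σ ∈ PM(H)` and `σ i ≠ σ₀ i` is even when every cell lies in
an even number of perfect matchings (it is the total multiplicity of the cells outside `σ₀`).
[folklore] -/
theorem even_sum_card_filter_ne {H : Finset (Fin n × Fin n)} (σ₀ : Perm (Fin n))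
    (heven : ∀ c : Fin n × Fin n, Even ((Finset.univ.filter fun σ : Perm (Fin n) =>
      (∀ i, (i, σ i) ∈ H) ∧ σ c.1 = c.2).card)) :
    Even (∑ σ ∈ (Finset.univ.filter fun σ : Perm (Fin n) => ∀ i, (i, σ i) ∈ H),
      (Finset.univ.filter fun i => σ₀ i ≠ σ i).card) := by
  classical
  -- exchange the two counts
  have hswap : ∑ σ ∈ (Finset.univ.filter fun σ : Perm (Fin n) => ∀ i, (i, σ i) ∈ H),
      (Finset.univ.filter fun i => σ₀ i ≠ σ i).card =
      ∑ i : Fin n, ((Finset.univ.filter fun σ : Perm (Fin n) => ∀ i, (i, σ i) ∈ H).filter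
        fun σ => σ₀ i ≠ σ i).card := by
    simp_rw [Finset.card_filter]
    rw [Finset.sum_comm]
  rw [hswap]
  refine Finset.even_sum _ fun i _ => ?_
  -- split the matchings with `σ i ≠ σ₀ i` by the value `σ i`
  have hsplit : ((Finset.univ.filter fun σ : Perm (Fin n) => ∀ i, (i, σ i) ∈ H).filter
      fun σ => σ₀ i ≠ σ i).card =
      ∑ j ∈ Finset.univ.erase (σ₀ i), (Finset.univ.filter fun σ : Perm (Fin n) =>
        (∀ i, (i, σ i) ∈ H) ∧ σ (i, j).1 = (i, j).2).card := by
    rw [Finset.card_eq_sum_card_fiberwise (f := fun σ : Perm (Fin n) => σ i)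
      (t := Finset.univ.erase (σ₀ i)) ?_]
    · refine Finset.sum_congr rfl fun j hj => ?_
      have hj' : j ≠ σ₀ i := (Finset.mem_erase.1 hj).1
      congr 1
      ext σ
      simp only [Finset.mem_filter, Finset.mem_univ, true_and]
      constructor
      · rintro ⟨⟨h1, _⟩, h3⟩
        exact ⟨h1, h3⟩
      · rintro ⟨h1, h3⟩
        exact ⟨⟨h1, fun h => hj' (by rw [← h3, h])⟩, h3⟩
    · intro σ hσ
      have h2 := (Finset.mem_filter.1 (Finset.mem_coe.1 hσ)).2
      exact Finset.mem_coe.2 (Finset.mem_erase.2 ⟨fun h => h2 h.symm, Finset.mem_univ _⟩)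
  rw [hsplit]
  exact Finset.even_sum _ fun j _ => heven (i, j)

/-- **Parity endgame.** Let `H ⊆ K_{n,n}` have an even number of perfect matchings, one of which,
`σ₀`, is adjacent to every other one, and suppose every cell lies in an even number of perfect
matchings of `H`. Then `H` is not Pfaffian: a Pólya signing would give `Π_σ sign σ = 1`
(`prod_prod_signing_eq_one`), whereas `sign σ₀ * sign σ = -(-1)^{#{i | σ₀ i ≠ σ i}}` for each of
the odd number of `σ ≠ σ₀` and `Σ_σ #{i | σ₀ i ≠ σ i}` is even (`even_sum_card_filter_ne`), giving
`Π_σ sign σ = -1`. [folklore] -/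
theorem not_isPfaffianBipartite_of_even_multiplicity {H : Finset (Fin n × Fin n)}
    {σ₀ : Perm (Fin n)} (hσ₀ : ∀ i, (i, σ₀ i) ∈ H)
    (hadj : ∀ σ : Perm (Fin n), (∀ i, (i, σ i) ∈ H) → σ ≠ σ₀ →
      ∀ ρ : Perm (Fin n), (∀ i, ρ i = σ₀ i ∨ ρ i = σ i) → ρ = σ₀ ∨ ρ = σ)
    (heven : ∀ c : Fin n × Fin n, Even ((Finset.univ.filter fun σ : Perm (Fin n) =>
      (∀ i, (i, σ i) ∈ H) ∧ σ c.1 = c.2).card))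
    (hcard : Even (Finset.univ.filter fun σ : Perm (Fin n) => ∀ i, (i, σ i) ∈ H).card) :
    ¬ IsPfaffianBipartite H := by
  classical
  rintro ⟨s, hs⟩
  set PM := Finset.univ.filter fun σ : Perm (Fin n) => ∀ i, (i, σ i) ∈ H with hPM
  have hmem : ∀ σ, σ ∈ PM ↔ ∀ i, (i, σ i) ∈ H := fun σ => by simp [hPM]
  have hσ₀PM : σ₀ ∈ PM := (hmem σ₀).2 hσ₀
  have hc : (PM.erase σ₀).card + 1 = PM.card := Finset.card_erase_add_one hσ₀PM
  -- (1) the product of the Pólya equations: `Π sign σ = 1`, in `ℤ`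
  have h1 : ∏ σ ∈ PM, Perm.sign σ = 1 := by
    have hprod : ∏ σ ∈ PM, (Perm.sign σ * ∏ i, s (i, σ i)) = 1 :=
      Finset.prod_eq_one fun σ hσ => hs σ ((hmem σ).1 hσ)
    rw [Finset.prod_mul_distrib, prod_prod_signing_eq_one s heven, mul_one] at hprod
    exact hprod
  have h1' : ∏ σ ∈ PM, ((Perm.sign σ : ℤˣ) : ℤ) = 1 := by
    rw [← Units.coe_prod, h1, Units.val_one]
  -- squares of signs
  have hsq : ∀ σ : Perm (Fin n), ((Perm.sign σ : ℤˣ) : ℤ) * ((Perm.sign σ : ℤˣ) : ℤ) = 1 :=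
    fun σ => by rw [← Units.val_mul, Int.units_mul_self, Units.val_one]
  -- (2) the cycle structure, multiplied over `σ ≠ σ₀`
  have h2 : ∏ σ ∈ PM.erase σ₀, (((Perm.sign σ₀ : ℤˣ) : ℤ) * ((Perm.sign σ : ℤˣ) : ℤ)) =
      ∏ σ ∈ PM.erase σ₀, -(-1 : ℤ) ^ (Finset.univ.filter fun i => σ₀ i ≠ σ i).card := by
    refine Finset.prod_congr rfl fun σ hσ => ?_
    obtain ⟨hne, hσPM⟩ := Finset.mem_erase.1 hσ
    exact coe_sign_mul_coe_sign_of_adjacent (Ne.symm hne) (hadj σ ((hmem σ).1 hσPM) hne)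
  -- left side: `sign σ₀ ^ (|PM| - 1) * Π_{σ ≠ σ₀} sign σ = sign σ₀ * Π_{σ ≠ σ₀} sign σ = 1`
  have hL : ∏ σ ∈ PM.erase σ₀, (((Perm.sign σ₀ : ℤˣ) : ℤ) * ((Perm.sign σ : ℤˣ) : ℤ)) = 1 := by
    rw [Finset.prod_mul_distrib, Finset.prod_const]
    obtain ⟨k, hk⟩ := hcard
    have hodd : (PM.erase σ₀).card % 2 = 1 := by omega
    rw [pow_eq_self_of_mul_self_eq_one (hsq σ₀) hodd,
      Finset.mul_prod_erase PM (fun σ => ((Perm.sign σ : ℤˣ) : ℤ)) hσ₀PM]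
    exact h1'
  -- right side: `(-1) ^ (Σ_{σ ≠ σ₀} (k σ + 1)) = -1`
  have hR : ∏ σ ∈ PM.erase σ₀, -(-1 : ℤ) ^ (Finset.univ.filter fun i => σ₀ i ≠ σ i).card = -1 := by
    have hneg : ∀ m : ℕ, -(-1 : ℤ) ^ m = (-1) ^ (m + 1) := fun m => by
      rw [_root_.pow_succ]; ring
    simp_rw [hneg]
    rw [Finset.prod_pow_eq_pow_sum, Finset.sum_add_distrib, Finset.sum_const, smul_eq_mul,
      mul_one]
    have hsum : ∑ σ ∈ PM.erase σ₀, (Finset.univ.filter fun i => σ₀ i ≠ σ i).card =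
        ∑ σ ∈ PM, (Finset.univ.filter fun i => σ₀ i ≠ σ i).card := by
      rw [← Finset.sum_erase_add _ _ hσ₀PM]
      simp
    rw [hsum]
    obtain ⟨a, ha⟩ := even_sum_card_filter_ne (H := H) σ₀ heven
    obtain ⟨k, hk⟩ := hcard
    have hodd : (∑ σ ∈ PM, (Finset.univ.filter fun i => σ₀ i ≠ σ i).card +
        (PM.erase σ₀).card) % 2 = 1 := by rw [ha]; omega
    exact pow_eq_self_of_mul_self_eq_one (by norm_num) hodd
  rw [hL, hR] at h2
  exact absurd h2 (by norm_num)

end Summit.ValiantsHypothesis.PolyaContinued
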